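import Summits.Ventures.Crystal3D.Theorems.StickyWulffConstantGenericWallFloorSteeringTwinCoreH
import Summits.Ventures.Crystal3D.Theorems.StickyWulffConstantGenericWallFloorSteeringTwinCoreL
import Summits.Ventures.Crystal3D.Theorems.StickyWulffConstantGenericWallFloorSteeringTwinCoreU
import HarnessLib

/-!
# Steering lemma, twin dozen: a move that climbs AND moves inward at a twin-dozen ball

HONEST FRAMING. Venture `Summits/Ventures/Crystal3D` (cell `crystal3d-full`), helper for the crux
`GenericWallFloor` (stmt-Ventures-19480) of `route-Ventures-StickyWulffConstant`, REGISTERED line `WallLedgerG`,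
open stub `stub_twoSlabAdhesion` (general fillings; ARCH v4 «coherent walks in tubes», lemma (S)).  Rung credit
only; F-C1 not moved.

`exists_steering_twinDozen`: at a twin-dozen ball (frame `A`, unit `{111}` normal `n` with the slot menu
`⟪A w, n⟫ ∈ {0, ±√(2/3)}`), for every orthonormal `z, q` one of the twelve AVAILABLE moves — an own slot `A w`
(`⟪A w, n⟫ ≤ 0`) or a mirror `A w − 2⟪A w, n⟫ n` of a near-polar slot (`⟪A w, n⟫ < 0`) — has both
`⟪·, z⟫ ≥ 1/32` and `⟪·, q⟫ ≥ 1/32`.  With `exists_steering_slot` (fcc dozen) this completes lemma (S): a coherent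
walker can always climb by `≥ 1/32` while steering toward its tube axis.  Proof: the near-polar triple
`w₁, w₂, w₃` labels the twelve available vectors as the anticuboctahedron `{A wᵢ, A wᵢ + 2√(2/3) n, A wᵢ − A wⱼ}`;
a steep available vector for `(z + q)/√2` exists (steep slots of `A` and of the twin frame, `exists_steep_slot`);
then the frame-free cores `anticubo_steer_H/L/U` (relabelled) finish.  Kit j292269 certifies the sharp constant
`0.14` numerically.
WHAT THIS IS NOT: not the stub; the tube assembly remains; F-C1 not moved.
-/

noncomputable section

namespace Summit.Ventures.Crystal3D.Theorems

open Summit.Ventures.Crystal3D Finset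
open Literature.MathematicalPhysics.StatisticalMechanics (fccStacking)
open scoped InnerProductSpace

set_option maxHeartbeats 800000 in
/-- **Steering lemma (twin dozen).**  See the module docstring. -/
theorem exists_steering_twinDozen (A : EuclideanSpace ℝ (Fin 3) ≃ₗᵢ[ℝ] EuclideanSpace ℝ (Fin 3))
    {n z q : EuclideanSpace ℝ (Fin 3)} (hn : ‖n‖ = 1) (hz : ‖z‖ = 1) (hq : ‖q‖ = 1) (hzq : ⟪z, q⟫_ℝ = 0)
    (hmenu : ∀ w ∈ fccSlots, ⟪A w, n⟫_ℝ = 0 ∨ ⟪A w, n⟫_ℝ = Real.sqrt (2 / 3) ∨ ⟪A w, n⟫_ℝ = -Real.sqrt (2 / 3)) :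
    (∃ w ∈ fccSlots, ⟪A w, n⟫_ℝ ≤ 0 ∧ (1 / 32 : ℝ) ≤ ⟪A w, z⟫_ℝ ∧ (1 / 32 : ℝ) ≤ ⟪A w, q⟫_ℝ) ∨
    (∃ w ∈ fccSlots, ⟪A w, n⟫_ℝ < 0 ∧ (1 / 32 : ℝ) ≤ ⟪A w - (2 * ⟪A w, n⟫_ℝ) • n, z⟫_ℝ ∧
      (1 / 32 : ℝ) ≤ ⟪A w - (2 * ⟪A w, n⟫_ℝ) • n, q⟫_ℝ) := by
  have hrpos : 0 < Real.sqrt (2 / 3) := Real.sqrt_pos.2 (by norm_num)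
  have hr2 : Real.sqrt (2 / 3) * Real.sqrt (2 / 3) = 2 / 3 := Real.mul_self_sqrt (by norm_num)
  have h14 : (1.4 : ℝ) < Real.sqrt 2 := by
    rw [show (1.4 : ℝ) = Real.sqrt (1.4 ^ 2) by rw [Real.sqrt_sq (by norm_num)]]
    exact Real.sqrt_lt_sqrt (by norm_num) (by norm_num)
  have hn' : ‖-n‖ = 1 := by rw [norm_neg, hn]
  have hmenu' : ∀ w ∈ fccSlots, ⟪A w, -n⟫_ℝ = 0 ∨ ⟪A w, -n⟫_ℝ = Real.sqrt (2 / 3) ∨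
      ⟪A w, -n⟫_ℝ = -Real.sqrt (2 / 3) := by
    intro w hw
    rcases hmenu w hw with h | h | h
    · exact Or.inl (by rw [inner_neg_right, h, neg_zero])
    · exact Or.inr (Or.inr (by rw [inner_neg_right, h]))
    · exact Or.inr (Or.inl (by rw [inner_neg_right, h, neg_neg]))
  -- the near-polar triple
  obtain ⟨w₁, hw₁, w₂, hw₂, w₃, hw₃, h12, h13, h23, e₁, e₂, e₃⟩ := exists_three_far_slots A hn' hmenu'
  rw [inner_neg_right, neg_eq_iff_eq_neg] at e₁ e₂ e₃
  have slot1 : ∀ {w}, w ∈ fccSlots → ‖A w‖ = 1 := fun hw => by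
    rw [LinearIsometryEquiv.norm_map, norm_eq_one_of_mem_fccSlots hw]
  have slotΛ : ∀ {w}, w ∈ fccSlots → A w ∈ A '' fccStacking 1 (Real.sqrt (2 / 3)) :=
    fun hw => ⟨_, mem_fcc_of_mem_fccSlots hw, rfl⟩
  have hpair : ∀ {a b}, a ∈ fccSlots → b ∈ fccSlots → a ≠ b → ⟪A a, n⟫_ℝ = -Real.sqrt (2 / 3) →
      ⟪A b, n⟫_ℝ = -Real.sqrt (2 / 3) → ⟪A a, A b⟫_ℝ = 1 / 2 := by
    intro a b ha hb hab han hbn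
    exact inner_eq_half_of_far_slots A (n := -n) (slotΛ ha) (slotΛ hb) (slot1 ha) (slot1 hb) hn'
      (by rw [inner_neg_right, han, neg_neg]) (by rw [inner_neg_right, hbn, neg_neg]) (fun e => hab (A.injective e))
  have p12 := hpair hw₁ hw₂ h12 e₁ e₂
  have p13 := hpair hw₁ hw₃ h13 e₁ e₃
  have p23 := hpair hw₂ hw₃ h23 e₂ e₃
  have p21 : ⟪A w₂, A w₁⟫_ℝ = 1 / 2 := by rw [real_inner_comm, p12]
  have p31 : ⟪A w₃, A w₁⟫_ℝ = 1 / 2 := by rw [real_inner_comm, p13]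
  have p32 : ⟪A w₃, A w₂⟫_ℝ = 1 / 2 := by rw [real_inner_comm, p23]
  -- the near-polar slots are exactly `w₁, w₂, w₃`
  have hnear : ∀ w ∈ fccSlots, ⟪A w, n⟫_ℝ = -Real.sqrt (2 / 3) → w = w₁ ∨ w = w₂ ∨ w = w₃ := by
    classical
    have hN3 : (fccSlots.filter fun w => 0 < ⟪A w, -n⟫_ℝ).card = 3 := card_far_slots_eq_three A hn' hmenu'
    have hNeq : (fccSlots.filter fun w => 0 < ⟪A w, -n⟫_ℝ) = {w₁, w₂, w₃} := by
      symm
      apply Finset.eq_of_subset_of_card_le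
      · intro w hw
        simp only [Finset.mem_insert, Finset.mem_singleton] at hw
        rw [mem_filter]
        rcases hw with rfl | rfl | rfl
        · exact ⟨hw₁, by rw [inner_neg_right, e₁, neg_neg]; exact hrpos⟩
        · exact ⟨hw₂, by rw [inner_neg_right, e₂, neg_neg]; exact hrpos⟩
        · exact ⟨hw₃, by rw [inner_neg_right, e₃, neg_neg]; exact hrpos⟩
      · rw [hN3, Finset.card_insert_of_notMem, Finset.card_insert_of_notMem, Finset.card_singleton]
        · simpa using h23
        · simp [h12, h13]
    intro w hw hwn
    have : w ∈ (fccSlots.filter fun w => 0 < ⟪A w, -n⟫_ℝ) :=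
      mem_filter.2 ⟨hw, by rw [inner_neg_right, hwn, neg_neg]; exact hrpos⟩
    rw [hNeq] at this
    simpa only [Finset.mem_insert, Finset.mem_singleton] using this
  -- differences of near-polar slots are (in-plane) slots
  have hdiff : ∀ {a b}, a ∈ fccSlots → b ∈ fccSlots → ⟪A a, A b⟫_ℝ = 1 / 2 → a - b ∈ fccSlots := by
    intro a b ha hb hab
    rw [LinearIsometryEquiv.inner_map_map] at hab
    refine mem_fccSlots_of_unit ?_ ?_
    · rw [sub_eq_add_neg]
      exact fcc_add_site_mem (mem_fcc_of_mem_fccSlots ha) (mem_fcc_of_mem_fccSlots (neg_mem_fccSlots hb))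
    · have : ‖a - b‖ ^ 2 = 1 := by
        rw [norm_sub_sq_real, norm_eq_one_of_mem_fccSlots ha, norm_eq_one_of_mem_fccSlots hb, hab]; norm_num
      exact (pow_eq_one_iff_of_nonneg (norm_nonneg _) two_ne_zero).1 this
  -- OUT: an anticuboctahedron vector with good components is an admissible move
  have out : ∀ d : EuclideanSpace ℝ (Fin 3), (d = A w₁ ∨ d = A w₂ ∨ d = A w₃ ∨ d = A w₁ + (2 * Real.sqrt (2 / 3)) • n ∨ d = A w₂ + (2 * Real.sqrt (2 / 3)) • n ∨ d = A w₃ + (2 * Real.sqrt (2 / 3)) • n ∨ d = A w₁ - A w₂ ∨ d = A w₂ - A w₁ ∨ d = A w₁ - A w₃ ∨ d = A w₃ - A w₁ ∨ d = A w₂ - A w₃ ∨ d = A w₃ - A w₂) →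
      (1 / 32 : ℝ) ≤ ⟪d, z⟫_ℝ → (1 / 32 : ℝ) ≤ ⟪d, q⟫_ℝ →
      (∃ w ∈ fccSlots, ⟪A w, n⟫_ℝ ≤ 0 ∧ (1 / 32 : ℝ) ≤ ⟪A w, z⟫_ℝ ∧ (1 / 32 : ℝ) ≤ ⟪A w, q⟫_ℝ) ∨
      (∃ w ∈ fccSlots, ⟪A w, n⟫_ℝ < 0 ∧ (1 / 32 : ℝ) ≤ ⟪A w - (2 * ⟪A w, n⟫_ℝ) • n, z⟫_ℝ ∧
        (1 / 32 : ℝ) ≤ ⟪A w - (2 * ⟪A w, n⟫_ℝ) • n, q⟫_ℝ) := by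
    intro d hd hdz hdq
    have mir : ∀ {w}, ⟪A w, n⟫_ℝ = -Real.sqrt (2 / 3) →
        A w - (2 * ⟪A w, n⟫_ℝ) • n = A w + (2 * Real.sqrt (2 / 3)) • n := by
      intro w hw; rw [hw, show (2 * -Real.sqrt (2 / 3)) = -(2 * Real.sqrt (2 / 3)) by ring, neg_smul, sub_neg_eq_add]
    rcases hd with rfl | rfl | rfl | rfl | rfl | rfl | rfl | rfl | rfl | rfl | rfl | rfl
    · exact Or.inl ⟨w₁, hw₁, by rw [e₁]; linarith, hdz, hdq⟩
    · exact Or.inl ⟨w₂, hw₂, by rw [e₂]; linarith, hdz, hdq⟩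
    · exact Or.inl ⟨w₃, hw₃, by rw [e₃]; linarith, hdz, hdq⟩
    · exact Or.inr ⟨w₁, hw₁, by rw [e₁]; linarith, by rw [mir e₁]; exact hdz, by rw [mir e₁]; exact hdq⟩
    · exact Or.inr ⟨w₂, hw₂, by rw [e₂]; linarith, by rw [mir e₂]; exact hdz, by rw [mir e₂]; exact hdq⟩
    · exact Or.inr ⟨w₃, hw₃, by rw [e₃]; linarith, by rw [mir e₃]; exact hdz, by rw [mir e₃]; exact hdq⟩
    · exact Or.inl ⟨w₁ - w₂, hdiff hw₁ hw₂ p12, by rw [map_sub, inner_sub_left, e₁, e₂]; linarith,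
        by rw [map_sub]; exact hdz, by rw [map_sub]; exact hdq⟩
    · exact Or.inl ⟨w₂ - w₁, hdiff hw₂ hw₁ p21, by rw [map_sub, inner_sub_left, e₂, e₁]; linarith,
        by rw [map_sub]; exact hdz, by rw [map_sub]; exact hdq⟩
    · exact Or.inl ⟨w₁ - w₃, hdiff hw₁ hw₃ p13, by rw [map_sub, inner_sub_left, e₁, e₃]; linarith,
        by rw [map_sub]; exact hdz, by rw [map_sub]; exact hdq⟩
    · exact Or.inl ⟨w₃ - w₁, hdiff hw₃ hw₁ p31, by rw [map_sub, inner_sub_left, e₃, e₁]; linarith,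
        by rw [map_sub]; exact hdz, by rw [map_sub]; exact hdq⟩
    · exact Or.inl ⟨w₂ - w₃, hdiff hw₂ hw₃ p23, by rw [map_sub, inner_sub_left, e₂, e₃]; linarith,
        by rw [map_sub]; exact hdz, by rw [map_sub]; exact hdq⟩
    · exact Or.inl ⟨w₃ - w₂, hdiff hw₃ hw₂ p32, by rw [map_sub, inner_sub_left, e₃, e₂]; linarith,
        by rw [map_sub]; exact hdz, by rw [map_sub]; exact hdq⟩
  -- IN: available moves are anticuboctahedron vectors
  have inT : ∀ w ∈ fccSlots, ⟪A w, n⟫_ℝ ≤ 0 → (A w = A w₁ ∨ A w = A w₂ ∨ A w = A w₃ ∨ A w = A w₁ + (2 * Real.sqrt (2 / 3)) • n ∨ A w = A w₂ + (2 * Real.sqrt (2 / 3)) • n ∨ A w = A w₃ + (2 * Real.sqrt (2 / 3)) • n ∨ A w = A w₁ - A w₂ ∨ A w = A w₂ - A w₁ ∨ A w = A w₁ - A w₃ ∨ A w = A w₃ - A w₁ ∨ A w = A w₂ - A w₃ ∨ A w = A w₃ - A w₂) := by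
    intro w hw hle
    rcases hmenu w hw with h0 | hp | hm
    · obtain ⟨a, ha, b, hb, hab⟩ := inPlane_eq_sub_of_nearPolar A hn hmenu hw h0 hw₁ hw₂ hw₃ h12 h13 h23 e₁ e₂ e₃
      have hw1 := norm_eq_one_of_mem_fccSlots hw
      simp only [Finset.mem_insert, Finset.mem_singleton] at ha hb
      rcases ha with rfl | rfl | rfl <;> rcases hb with rfl | rfl | rfl <;>
        first
        | (exfalso; rw [sub_self] at hab; rw [hab, norm_zero] at hw1; norm_num at hw1)
        | (rw [hab, map_sub]; simp only [true_or, or_true])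
    · rw [hp] at hle; linarith
    · rcases hnear w hw hm with rfl | rfl | rfl <;> simp only [true_or, or_true]
  have inT' : ∀ w ∈ fccSlots, ⟪A w, n⟫_ℝ < 0 → (A w - (2 * ⟪A w, n⟫_ℝ) • n = A w₁ ∨ A w - (2 * ⟪A w, n⟫_ℝ) • n = A w₂ ∨ A w - (2 * ⟪A w, n⟫_ℝ) • n = A w₃ ∨ A w - (2 * ⟪A w, n⟫_ℝ) • n = A w₁ + (2 * Real.sqrt (2 / 3)) • n ∨ A w - (2 * ⟪A w, n⟫_ℝ) • n = A w₂ + (2 * Real.sqrt (2 / 3)) • n ∨ A w - (2 * ⟪A w, n⟫_ℝ) • n = A w₃ + (2 * Real.sqrt (2 / 3)) • n ∨ A w - (2 * ⟪A w, n⟫_ℝ) • n = A w₁ - A w₂ ∨ A w - (2 * ⟪A w, n⟫_ℝ) • n = A w₂ - A w₁ ∨ A w - (2 * ⟪A w, n⟫_ℝ) • n = A w₁ - A w₃ ∨ A w - (2 * ⟪A w, n⟫_ℝ) • n = A w₃ - A w₁ ∨ A w - (2 * ⟪A w, n⟫_ℝ) • n = A w₂ - A w₃ ∨ A w - (2 *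 ⟪A w, n⟫_ℝ) • n = A w₃ - A w₂) := by
    intro w hw hlt
    have hm : ⟪A w, n⟫_ℝ = -Real.sqrt (2 / 3) := by
      rcases hmenu w hw with h | h | h
      · rw [h] at hlt; exact absurd hlt (lt_irrefl 0)
      · rw [h] at hlt; linarith
      · exact h
    have mir : A w - (2 * ⟪A w, n⟫_ℝ) • n = A w + (2 * Real.sqrt (2 / 3)) • n := by
      rw [hm, show (2 * -Real.sqrt (2 / 3)) = -(2 * Real.sqrt (2 / 3)) by ring, neg_smul, sub_neg_eq_add]
    rw [mir]
    rcases hnear w hw hm with rfl | rfl | rfl <;> simp only [true_or, or_true]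
  -- STEEP available vector for any unit direction
  have steepT : ∀ θ : EuclideanSpace ℝ (Fin 3), ‖θ‖ = 1 → ∃ d : EuclideanSpace ℝ (Fin 3), (d = A w₁ ∨ d = A w₂ ∨ d = A w₃ ∨ d = A w₁ + (2 * Real.sqrt (2 / 3)) • n ∨ d = A w₂ + (2 * Real.sqrt (2 / 3)) • n ∨ d = A w₃ + (2 * Real.sqrt (2 / 3)) • n ∨ d = A w₁ - A w₂ ∨ d = A w₂ - A w₁ ∨ d = A w₁ - A w₃ ∨ d = A w₃ - A w₁ ∨ d = A w₂ - A w₃ ∨ d = A w₃ - A w₂) ∧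
      Real.sqrt 2 / 2 ≤ ⟪d, θ⟫_ℝ := by
    intro θ hθ
    obtain ⟨w, hwΛ, hwn1, hwθ⟩ := exists_steep_slot (A.symm θ) (by rw [LinearIsometryEquiv.norm_map, hθ])
    have hw : w ∈ fccSlots := mem_fccSlots_of_unit hwΛ hwn1
    rw [← LinearIsometryEquiv.inner_map_map A w, LinearIsometryEquiv.apply_symm_apply] at hwθ
    by_cases hle : ⟪A w, n⟫_ℝ ≤ 0
    · exact ⟨A w, inT w hw hle, hwθ⟩
    push Not at hle
    have hwfar : ⟪A w, n⟫_ℝ = Real.sqrt (2 / 3) := by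
      rcases hmenu w hw with h | h | h
      · rw [h] at hle; exact absurd hle (lt_irrefl 0)
      · exact h
      · rw [h] at hle; linarith
    obtain ⟨F', hF'⟩ := exists_twinFrame A hn
    obtain ⟨w', hw'Λ, hw'n1, hw'θ⟩ := exists_steep_slot (F'.symm θ) (by rw [LinearIsometryEquiv.norm_map, hθ])
    have hw' : w' ∈ fccSlots := mem_fccSlots_of_unit hw'Λ hw'n1
    rw [← LinearIsometryEquiv.inner_map_map F' w', LinearIsometryEquiv.apply_symm_apply, hF'] at hw'θ
    rcases hmenu w' hw' with h0 | hp | hm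
    · refine ⟨A w', inT w' hw' h0.le, ?_⟩
      rw [h0, mul_zero, zero_smul, sub_zero] at hw'θ; exact hw'θ
    · -- both steep vectors would be far on opposite sides: impossible
      exfalso
      have ha1 : ‖A w‖ = 1 := slot1 hw
      have hb1 : ‖A w' - (2 * ⟪A w', n⟫_ℝ) • n‖ = 1 := by rw [← hF', LinearIsometryEquiv.norm_map, norm_eq_one_of_mem_fccSlots hw']
      have hsum : Real.sqrt 2 ≤ ⟪A w + (A w' - (2 * ⟪A w', n⟫_ℝ) • n), θ⟫_ℝ := by rw [inner_add_left]; linarith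
      have hcs := real_inner_le_norm (A w + (A w' - (2 * ⟪A w', n⟫_ℝ) • n)) θ
      rw [hθ, mul_one] at hcs
      have hns : ‖A w + (A w' - (2 * ⟪A w', n⟫_ℝ) • n)‖ ^ 2 = 2 + 2 * ⟪A w, A w' - (2 * ⟪A w', n⟫_ℝ) • n⟫_ℝ := by
        rw [norm_add_sq_real, ha1, hb1]; ring
      have hip : ⟪A w, A w' - (2 * ⟪A w', n⟫_ℝ) • n⟫_ℝ ≤ -(1 / 3) := by
        rw [inner_sub_right, inner_smul_right, hp, hwfar, LinearIsometryEquiv.inner_map_map]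
        have := (abs_le.1 (by have h := abs_real_inner_le_norm w w'; rwa [hwn1, hw'n1, one_mul] at h :
          |⟪w, w'⟫_ℝ| ≤ 1)).2
        nlinarith [hr2]
      nlinarith [norm_nonneg (A w + (A w' - (2 * ⟪A w', n⟫_ℝ) • n)), h14]
    · exact ⟨A w' - (2 * ⟪A w', n⟫_ℝ) • n, inT' w' hw' (by rw [hm]; linarith), hw'θ⟩
  -- the unit vector `ν = (z + q)/√2`, its steep available vector `u`, and the steep `v` for `q`
  set ν : EuclideanSpace ℝ (Fin 3) := (Real.sqrt 2 / 2) • (z + q) with hν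
  have hν1 : ‖ν‖ = 1 := by
    have hzq2 : ‖z + q‖ ^ 2 = 2 := by rw [norm_add_sq_real, hz, hq, hzq]; norm_num
    have : ‖ν‖ ^ 2 = 1 := by
      rw [hν, norm_smul, mul_pow, hzq2, Real.norm_eq_abs, sq_abs, div_pow, Real.sq_sqrt (by norm_num)]; norm_num
    exact (pow_eq_one_iff_of_nonneg (norm_nonneg _) two_ne_zero).1 this
  obtain ⟨u, huT, huν⟩ := steepT ν hν1
  obtain ⟨v, hvT, hvq⟩ := steepT q hq
  rw [hν, inner_smul_right, inner_add_right] at huν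
  have hsum : 1 ≤ ⟪u, z⟫_ℝ + ⟪u, q⟫_ℝ := by
    have hs : 0 < Real.sqrt 2 := by linarith
    nlinarith
  clear_value ν
  by_cases hb : ⟪u, q⟫_ℝ < 1 / 32
  · -- dispatch on the position of `u`
    rcases huT with rfl | rfl | rfl | rfl | rfl | rfl | rfl | rfl | rfl | rfl | rfl | rfl
    · obtain ⟨d, hd, hdz, hdq⟩ := anticubo_steer_L (z := z) (q := q) (v := v) (slot1 hw₁) (slot1 hw₂) (slot1 hw₃) p12 p13 p23 hn e₁ e₂ e₃ hz hsum hb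
        (by rcases hvT with h | h | h | h | h | h | h | h | h | h | h | h <;> simp only [h, true_or, or_true]) hvq
      exact out d (by rcases hd with h | h | h | h | h | h | h | h | h | h | h | h <;> simp only [h, true_or, or_true]) hdz hdq
    · obtain ⟨d, hd, hdz, hdq⟩ := anticubo_steer_L (z := z) (q := q) (v := v) (slot1 hw₂) (slot1 hw₁) (slot1 hw₃) p21 p23 p13 hn e₂ e₁ e₃ hz hsum hb
        (by rcases hvT with h | h | h | h | h | h | h | h | h | h | h | h <;> simp only [h, true_or, or_true]) hvq
      exact out d (by rcases hd with h | h | h | h | h | h | h | h | h | h | h | h <;> simp only [h, true_or, or_true]) hdz hdq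
    · obtain ⟨d, hd, hdz, hdq⟩ := anticubo_steer_L (z := z) (q := q) (v := v) (slot1 hw₃) (slot1 hw₁) (slot1 hw₂) p31 p32 p12 hn e₃ e₁ e₂ hz hsum hb
        (by rcases hvT with h | h | h | h | h | h | h | h | h | h | h | h <;> simp only [h, true_or, or_true]) hvq
      exact out d (by rcases hd with h | h | h | h | h | h | h | h | h | h | h | h <;> simp only [h, true_or, or_true]) hdz hdq
    · obtain ⟨d, hd, hdz, hdq⟩ := anticubo_steer_U (z := z) (q := q) (v := v) (slot1 hw₁) (slot1 hw₂) (slot1 hw₃) p12 p13 p23 hn e₁ e₂ e₃ hz hsum hb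
        (by rcases hvT with h | h | h | h | h | h | h | h | h | h | h | h <;> simp only [h, true_or, or_true]) hvq
      exact out d (by rcases hd with h | h | h | h | h | h | h | h | h | h | h | h <;> simp only [h, true_or, or_true]) hdz hdq
    · obtain ⟨d, hd, hdz, hdq⟩ := anticubo_steer_U (z := z) (q := q) (v := v) (slot1 hw₂) (slot1 hw₁) (slot1 hw₃) p21 p23 p13 hn e₂ e₁ e₃ hz hsum hb
        (by rcases hvT with h | h | h | h | h | h | h | h | h | h | h | h <;> simp only [h, true_or, or_true]) hvq
      exact out d (by rcases hd with h | h | h | h | h | h | h | h | h | h | h | h <;> simp only [h, true_or, or_true]) hdz hdq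
    · obtain ⟨d, hd, hdz, hdq⟩ := anticubo_steer_U (z := z) (q := q) (v := v) (slot1 hw₃) (slot1 hw₁) (slot1 hw₂) p31 p32 p12 hn e₃ e₁ e₂ hz hsum hb
        (by rcases hvT with h | h | h | h | h | h | h | h | h | h | h | h <;> simp only [h, true_or, or_true]) hvq
      exact out d (by rcases hd with h | h | h | h | h | h | h | h | h | h | h | h <;> simp only [h, true_or, or_true]) hdz hdq
    · obtain ⟨d, hd, hdz, hdq⟩ := anticubo_steer_H (z := z) (q := q) (v := v) (slot1 hw₁) (slot1 hw₂) (slot1 hw₃) p12 p13 p23 hn e₁ e₂ e₃ hz hsum hb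
        (by rcases hvT with h | h | h | h | h | h | h | h | h | h | h | h <;> simp only [h, true_or, or_true]) hvq
      exact out d (by rcases hd with h | h | h | h | h | h | h | h | h | h | h | h <;> simp only [h, true_or, or_true]) hdz hdq
    · obtain ⟨d, hd, hdz, hdq⟩ := anticubo_steer_H (z := z) (q := q) (v := v) (slot1 hw₂) (slot1 hw₁) (slot1 hw₃) p21 p23 p13 hn e₂ e₁ e₃ hz hsum hb
        (by rcases hvT with h | h | h | h | h | h | h | h | h | h | h | h <;> simp only [h, true_or, or_true]) hvq
      exact out d (by rcases hd with h | h | h | h | h | h | h | h | h | h | h | h <;> simp only [h, true_or, or_true]) hdz hdq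
    · obtain ⟨d, hd, hdz, hdq⟩ := anticubo_steer_H (z := z) (q := q) (v := v) (slot1 hw₁) (slot1 hw₃) (slot1 hw₂) p13 p12 p32 hn e₁ e₃ e₂ hz hsum hb
        (by rcases hvT with h | h | h | h | h | h | h | h | h | h | h | h <;> simp only [h, true_or, or_true]) hvq
      exact out d (by rcases hd with h | h | h | h | h | h | h | h | h | h | h | h <;> simp only [h, true_or, or_true]) hdz hdq
    · obtain ⟨d, hd, hdz, hdq⟩ := anticubo_steer_H (z := z) (q := q) (v := v) (slot1 hw₃) (slot1 hw₁) (slot1 hw₂) p31 p32 p12 hn e₃ e₁ e₂ hz hsum hb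
        (by rcases hvT with h | h | h | h | h | h | h | h | h | h | h | h <;> simp only [h, true_or, or_true]) hvq
      exact out d (by rcases hd with h | h | h | h | h | h | h | h | h | h | h | h <;> simp only [h, true_or, or_true]) hdz hdq
    · obtain ⟨d, hd, hdz, hdq⟩ := anticubo_steer_H (z := z) (q := q) (v := v) (slot1 hw₂) (slot1 hw₃) (slot1 hw₁) p23 p21 p31 hn e₂ e₃ e₁ hz hsum hb
        (by rcases hvT with h | h | h | h | h | h | h | h | h | h | h | h <;> simp only [h, true_or, or_true]) hvq
      exact out d (by rcases hd with h | h | h | h | h | h | h | h | h | h | h | h <;> simp only [h, true_or, or_true]) hdz hdq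
    · obtain ⟨d, hd, hdz, hdq⟩ := anticubo_steer_H (z := z) (q := q) (v := v) (slot1 hw₃) (slot1 hw₂) (slot1 hw₁) p32 p31 p21 hn e₃ e₂ e₁ hz hsum hb
        (by rcases hvT with h | h | h | h | h | h | h | h | h | h | h | h <;> simp only [h, true_or, or_true]) hvq
      exact out d (by rcases hd with h | h | h | h | h | h | h | h | h | h | h | h <;> simp only [h, true_or, or_true]) hdz hdq
  by_cases ha : ⟪u, z⟫_ℝ < 1 / 32
  · obtain ⟨v', hv'T, hv'z⟩ := steepT z hz
    rcases huT with rfl | rfl | rfl | rfl | rfl | rfl | rfl | rfl | rfl | rfl | rfl | rfl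
    · obtain ⟨d, hd, hdz, hdq⟩ := anticubo_steer_L (z := q) (q := z) (v := v') (slot1 hw₁) (slot1 hw₂) (slot1 hw₃) p12 p13 p23 hn e₁ e₂ e₃ hq (by linarith) ha
        (by rcases hv'T with h | h | h | h | h | h | h | h | h | h | h | h <;> simp only [h, true_or, or_true]) hv'z
      exact out d (by rcases hd with h | h | h | h | h | h | h | h | h | h | h | h <;> simp only [h, true_or, or_true]) hdq hdz
    · obtain ⟨d, hd, hdz, hdq⟩ := anticubo_steer_L (z := q) (q := z) (v := v') (slot1 hw₂) (slot1 hw₁) (slot1 hw₃) p21 p23 p13 hn e₂ e₁ e₃ hq (by linarith) ha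
        (by rcases hv'T with h | h | h | h | h | h | h | h | h | h | h | h <;> simp only [h, true_or, or_true]) hv'z
      exact out d (by rcases hd with h | h | h | h | h | h | h | h | h | h | h | h <;> simp only [h, true_or, or_true]) hdq hdz
    · obtain ⟨d, hd, hdz, hdq⟩ := anticubo_steer_L (z := q) (q := z) (v := v') (slot1 hw₃) (slot1 hw₁) (slot1 hw₂) p31 p32 p12 hn e₃ e₁ e₂ hq (by linarith) ha
        (by rcases hv'T with h | h | h | h | h | h | h | h | h | h | h | h <;> simp only [h, true_or, or_true]) hv'z
      exact out d (by rcases hd with h | h | h | h | h | h | h | h | h | h | h | h <;> simp only [h, true_or, or_true]) hdq hdz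
    · obtain ⟨d, hd, hdz, hdq⟩ := anticubo_steer_U (z := q) (q := z) (v := v') (slot1 hw₁) (slot1 hw₂) (slot1 hw₃) p12 p13 p23 hn e₁ e₂ e₃ hq (by linarith) ha
        (by rcases hv'T with h | h | h | h | h | h | h | h | h | h | h | h <;> simp only [h, true_or, or_true]) hv'z
      exact out d (by rcases hd with h | h | h | h | h | h | h | h | h | h | h | h <;> simp only [h, true_or, or_true]) hdq hdz
    · obtain ⟨d, hd, hdz, hdq⟩ := anticubo_steer_U (z := q) (q := z) (v := v') (slot1 hw₂) (slot1 hw₁) (slot1 hw₃) p21 p23 p13 hn e₂ e₁ e₃ hq (by linarith) ha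
        (by rcases hv'T with h | h | h | h | h | h | h | h | h | h | h | h <;> simp only [h, true_or, or_true]) hv'z
      exact out d (by rcases hd with h | h | h | h | h | h | h | h | h | h | h | h <;> simp only [h, true_or, or_true]) hdq hdz
    · obtain ⟨d, hd, hdz, hdq⟩ := anticubo_steer_U (z := q) (q := z) (v := v') (slot1 hw₃) (slot1 hw₁) (slot1 hw₂) p31 p32 p12 hn e₃ e₁ e₂ hq (by linarith) ha
        (by rcases hv'T with h | h | h | h | h | h | h | h | h | h | h | h <;> simp only [h, true_or, or_true]) hv'z
      exact out d (by rcases hd with h | h | h | h | h | h | h | h | h | h | h | h <;> simp only [h, true_or, or_true]) hdq hdz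
    · obtain ⟨d, hd, hdz, hdq⟩ := anticubo_steer_H (z := q) (q := z) (v := v') (slot1 hw₁) (slot1 hw₂) (slot1 hw₃) p12 p13 p23 hn e₁ e₂ e₃ hq (by linarith) ha
        (by rcases hv'T with h | h | h | h | h | h | h | h | h | h | h | h <;> simp only [h, true_or, or_true]) hv'z
      exact out d (by rcases hd with h | h | h | h | h | h | h | h | h | h | h | h <;> simp only [h, true_or, or_true]) hdq hdz
    · obtain ⟨d, hd, hdz, hdq⟩ := anticubo_steer_H (z := q) (q := z) (v := v') (slot1 hw₂) (slot1 hw₁) (slot1 hw₃) p21 p23 p13 hn e₂ e₁ e₃ hq (by linarith) ha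
        (by rcases hv'T with h | h | h | h | h | h | h | h | h | h | h | h <;> simp only [h, true_or, or_true]) hv'z
      exact out d (by rcases hd with h | h | h | h | h | h | h | h | h | h | h | h <;> simp only [h, true_or, or_true]) hdq hdz
    · obtain ⟨d, hd, hdz, hdq⟩ := anticubo_steer_H (z := q) (q := z) (v := v') (slot1 hw₁) (slot1 hw₃) (slot1 hw₂) p13 p12 p32 hn e₁ e₃ e₂ hq (by linarith) ha
        (by rcases hv'T with h | h | h | h | h | h | h | h | h | h | h | h <;> simp only [h, true_or, or_true]) hv'z
      exact out d (by rcases hd with h | h | h | h | h | h | h | h | h | h | h | h <;> simp only [h, true_or, or_true]) hdq hdz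
    · obtain ⟨d, hd, hdz, hdq⟩ := anticubo_steer_H (z := q) (q := z) (v := v') (slot1 hw₃) (slot1 hw₁) (slot1 hw₂) p31 p32 p12 hn e₃ e₁ e₂ hq (by linarith) ha
        (by rcases hv'T with h | h | h | h | h | h | h | h | h | h | h | h <;> simp only [h, true_or, or_true]) hv'z
      exact out d (by rcases hd with h | h | h | h | h | h | h | h | h | h | h | h <;> simp only [h, true_or, or_true]) hdq hdz
    · obtain ⟨d, hd, hdz, hdq⟩ := anticubo_steer_H (z := q) (q := z) (v := v') (slot1 hw₂) (slot1 hw₃) (slot1 hw₁) p23 p21 p31 hn e₂ e₃ e₁ hq (by linarith) ha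
        (by rcases hv'T with h | h | h | h | h | h | h | h | h | h | h | h <;> simp only [h, true_or, or_true]) hv'z
      exact out d (by rcases hd with h | h | h | h | h | h | h | h | h | h | h | h <;> simp only [h, true_or, or_true]) hdq hdz
    · obtain ⟨d, hd, hdz, hdq⟩ := anticubo_steer_H (z := q) (q := z) (v := v') (slot1 hw₃) (slot1 hw₂) (slot1 hw₁) p32 p31 p21 hn e₃ e₂ e₁ hq (by linarith) ha
        (by rcases hv'T with h | h | h | h | h | h | h | h | h | h | h | h <;> simp only [h, true_or, or_true]) hv'z
      exact out d (by rcases hd with h | h | h | h | h | h | h | h | h | h | h | h <;> simp only [h, true_or, or_true]) hdq hdz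
  · push Not at ha hb
    exact out u huT ha hb

end Summit.Ventures.Crystal3D.Theorems

end

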